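/-
COR-CM (cell pub-hodgecm2, stage 2 of the Hodge ladder) — Δ2 BRIDGE, X1 (J) pin, piece **(J2) «ALBANESE ON COMPONENTS»**,
HOLE-FREE GENERIC CORE: Liu's Albanese morphism `α_K : ∇X_K → A_K` ([Liu2021] §2.1 Def. 2.3, §4.2 (4.1)) of an ARBITRARY
Albanese datum, base-changed to `ℂ` and RESTRICTED TO ONE GEOMETRIC PIECE `Y ↪ X ⊗_k ℂ` with a chosen point — the map
`(α_K)_x|_{X_c} : X_c → A_K ⊗ ℂ` of the proof of [Liu2021] Lemma 2.4 (1) (FJcycle.tex l. 1220–1222) — with its laws: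
base-point change is a translation (so `H¹` does not see it), ONE Jacobian factorisation `(α_K)_x|_Y = f^x ≫ ψ` for all
`x`, and the transition ∕ Hecke square along any morphism `u : X' → X` carrying Albanese functoriality data
(`Sec42Data.nablaTr ∕ Atr ∕ α_Atr`, `HeckeTranslates.albTr`).  Provisional fifth hand own-crow g92
(prover-pub-hodgecm-own-crow-g92-0) for the SEAT ASK d2bridge-prove-5 (pub-hodgecm2 OPS-REQUESTS l. 377).  Literature-only
imports (no `HodgeCM.Model.*`, no manifest path); nothing landed is edited or restated.  FRAMING: HC_CM is NOT proved;
«Δ2 BRIDGE CLOSED» is NOT claimed; the PIN instance `albOnComponent K h` (Model cone) is NOT in this file.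
-/
import Literature.NumberTheory.Automorphic.Liu2021.NablaGaloisDescent
import Literature.AlgebraicGeometry.Motives.JacobianBasePoint
import Literature.AlgebraicGeometry.Motives.AbelianVarietyComplexPoints
import Literature.AlgebraicGeometry.Motives.AlbaneseExistenceComplex
import Literature.AlgebraicGeometry.HodgeTheory.BettiUniverseAxioms
import HarnessLib

/-!
# Δ2 bridge, (J2) core: the Albanese morphism on a geometric piece, `(α_K)_x|_{X_c} : X_c ⟶ A_K ⊗_{k} ℂ`

[Liu2021] Y. Liu, *Fourier–Jacobi cycles and arithmetic relative trace formula*, Camb. J. Math. 9 (2021) =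
arXiv:2102.11518.  Def. 2.1 (1) (l. 1171–1174): `∇X ⊆ X × X` the smallest open and closed subscheme containing the
diagonal; Def. 2.3 (l. 1202–1208): the Albanese morphism `α_X : ∇X → Alb_X`; proof of Lemma 2.4 (1) (l. 1220–1222): «we
pick an element `x ∈ X(π₀(X ⊗_{k,τ} ℂ))`, which induces a morphism `(α_X)_x : X ⊗_{k,τ} ℂ → Alb_X ⊗_{k,τ} ℂ`» — on the
connected component `X_c ∋ x` this is `y ↦ α_X(y, x)`, through `X_c × {x} ⊆ X_c × X_c ⊆ (∇X)_ℂ`; §4.2 (4.1) and the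
proof of Thm. 4.18 (l. 2247–2253) pull classes back along it.

Setting (as in `Liu2021/AlbaneseBaseChangeJointlyEpi`): `{k : Type} [Field k] [Algebra k ℂ]` (at the pin
`letI := ι₁.toAlgebra`), `X : SchemeOver k`, `a : AppendixC.Albanese X` ANY Albanese datum (Liu's `C.alb K`, chosen by
`Classical.choice` in `Model.sec42DataOf`), a piece `inj : Y ⟶ X ⊗_k ℂ` with `Y` geometrically irreducible over `ℂ` (at
the pin: a leg of the `hUnif` cofan, `Y ≅ P_Γ`), a point `y₀ : AlgPoints Y ℂ`.

* §1 `nablaLiftPiece a inj : Y ⊗ Y ⟶ (∇X)_ℂ` — the lift of `inj × inj` through the open and closed `(∇X)_ℂ ↪ (X × X)_ℂ`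
  (the irreducible `Y × Y` meets it on the diagonal; the argument of `Liu2021/NablaOfPieces`,
  `range_tensorHom_subset_range_incl`, run after base change), `nablaLiftPiece_incl`, `diag_nablaLiftPiece`.
* §2 `albPair a inj : Y ⊗ Y ⟶ (A ⊗_k ℂ)` := `nablaLiftPiece ≫ (α)_ℂ`, trivial on the diagonal (`diag_albPair`);
  `albOnPiece a inj y₀ : Y ⟶ (A ⊗_k ℂ)` := `albPair` on `Y × {y₀}` — Liu's `(α_X)_x|_{X_c}`; `point_albOnPiece`.
* §3 ONE Jacobian factorisation: for any `𝒥 : Jacobian Y`, `albDesc a inj 𝒥 := 𝒥.desc (albPair a inj) _ : J(Y) ⟶ A ⊗ ℂ`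
  and `albOnPiece a inj y₀ = 𝒥.abelJacobi y₀ ≫ (albDesc …)` for EVERY `y₀` (`albOnPiece_eq_abelJacobi_comp`).
* §4 base point: `albOnPiece a inj y₁ = albOnPiece a inj y₀ * const` (`albOnPiece_eq_mul_const`) and
  `pull (albOnPiece a inj y₁) i = pull (albOnPiece a inj y₀) i` (`pull_albOnPiece_eq_of_point`; translations of the
  path-connected `A(ℂ)` act trivially on `Hⁱ`, tree `AbelianVariety.bettiCohomology_map_mul_const`).
* §5 the TRANSITION SQUARE: for `u : X' ⟶ X`, data `a'`, `a`, `nT : ∇X' → ∇X` over `u × u` and `At : A' → A` with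
  `α' ≫ At = nT ≫ α` (VERBATIM the fields `nablaTr ∕ nablaTr_incl ∕ Atr ∕ α_Atr` of `AppendixC.Sec42Data`), pieces
  `inj'`, `inj` and `v : Y' ⟶ Y` over `u_ℂ`: `albPair a' inj' ≫ (At)_ℂ = (v × v) ≫ albPair a inj`
  (`albPair_comp_baseChange`), `albOnPiece a' inj' y' ≫ (At)_ℂ = v ≫ albOnPiece a inj (y' ≫ v)`
  (`albOnPiece_comp_baseChange`), and on `Hⁱ` with ANY base points (`pull_albOnPiece_comp_baseChange`).  The sequel
  `CorCM/D2Bridge/AlbaneseOnPieceFunctorial.lean` instantiates §5 at `Albanese.map` (Def. 2.3 `Alb_u`), at the transition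
  homomorphisms `Sec42Data.Atr` (LAW (iii)) and at the Hecke translates `HeckeTranslates.albTr` (LAW (iv)).

Everything is proved from tree theorems (Mathlib's cartesian-monoidal `Over.pullback`, `IsOpenImmersion.lift`,
`Jacobian.fac`, `Jacobian.abelJacobi_eq_mul_const`, `AbelianVariety.bettiCohomology_map_mul_const`); no named fact, no
`sorry`.  The consumer-side PIN (`albOnComponent K h := e_h.hom ≫ albOnPiece (C.alb K) (inj h) (y h)` with `e_h : P_Γ ≅ Y_h`
the model match of the `hUnif` piece) lives in the Model cone and is not built here.  HC_CM is NOT proved.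

## References
* [Liu2021] Y. Liu, arXiv:2102.11518 = Camb. J. Math. 9 (2021): §2.1 Def. 2.1 (1) (l. 1171–1174), Def. 2.3 (l. 1202–1208),
  Lemma 2.4 (1) with proof (l. 1210–1228); §4.2 l. 2066–2074 and (4.1); proof of Thm. 4.18 (l. 2247–2253).
* [Milne1986JacobianVarieties] J. S. Milne, *Jacobian Varieties* (1986), §2 (`f^{P'}` is a translate of `f^P`), §6 Prop. 6.1, 6.4.
* [HatcherAT2002] A. Hatcher, *Algebraic Topology*, CUP 2002, §3.1 p. 201 (homotopy invariance).
-/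

set_option autoImplicit false

noncomputable section

open CategoryTheory CategoryTheory.Limits AlgebraicGeometry MonoidalCategory CartesianMonoidalCategory NumberField
open Literature.AlgebraicGeometry.Motives
open Literature.AlgebraicGeometry.HodgeTheory
open Literature.NumberTheory.Automorphic.Liu2021.AppendixC
open scoped MonObj

namespace Summit.HodgeConjecture.CorCM.D2Bridge

open AbelianVariety (bcSpec bcFunctor)

variable {k : Type} [Field k] [Algebra k ℂ] {X : SchemeOver k} (a : Albanese X)
  {Y : SchemeOver ℂ} (inj : Y ⟶ (bcFunctor k ℂ).obj X)

/-! ## §1 The lift of a piece `Y × Y` into `(∇X)_ℂ` -/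

/-- The diagonal of the piece followed by `inj × inj` is `inj` followed by the base-changed diagonal `(ΔX)_ℂ` (read in
`(X × X)_ℂ` through the monoidal structure isomorphism `μ : X_ℂ × X_ℂ ⥲ (X × X)_ℂ` of `Over.pullback`, Mathlib
`Functor.Monoidal.lift_μ`). [folklore] -/
theorem diag_tensorHom_μ :
    lift (𝟙 Y) (𝟙 Y) ≫ (inj ⊗ₘ inj) ≫ Functor.LaxMonoidal.μ (bcFunctor k ℂ) X X =
      inj ≫ (bcFunctor k ℂ).map (lift (𝟙 X) (𝟙 X)) := by
  rw [← Functor.Monoidal.lift_μ, CategoryTheory.Functor.map_id, lift_map_assoc, Category.id_comp, comp_lift_assoc,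
    Category.comp_id]

/-- **The self-product of a geometrically irreducible piece of `X ⊗_k ℂ` lies in `(∇X)_ℂ`** (Def. 2.1 (1) after base
change): the image of `inj × inj : Y × Y → (X × X)_ℂ` is contained in the image of the open and closed immersion
`(∇X)_ℂ ↪ (X × X)_ℂ` — it is the continuous image of the irreducible `Y ×_ℂ Y`, hence preconnected, and meets `(∇X)_ℂ` on the
diagonal (Mathlib `IsPreconnected.subset_isClopen`; immersions are stable under base change,
`GaloisDescent.isOpenImmersion_bcFunctor_map_left` ∕ `isClosedImmersion_bcFunctor_map_left`).  The argument of
`range_tensorHom_subset_range_incl` (`Liu2021/NablaOfPieces`) for the base-changed carrier. [cite: Liu2021, §2.1 Def. 2.1 (1) (l. 1171–1174) and proof of Lemma 2.4 (1) (l. 1220–1222)] -/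
theorem range_tensorHom_μ_subset_range [GeometricallyIrreducible Y.hom] :
    Set.range ⇑((inj ⊗ₘ inj) ≫ Functor.LaxMonoidal.μ (bcFunctor k ℂ) X X).left ⊆
      Set.range ⇑((bcFunctor k ℂ).map a.nabla.incl).left := by
  haveI := a.nabla.isOpenImmersion_incl
  haveI := a.nabla.isClosedImmersion_incl
  haveI := GaloisDescent.isOpenImmersion_bcFunctor_map_left ℂ a.nabla.incl
  haveI := GaloisDescent.isClosedImmersion_bcFunctor_map_left ℂ a.nabla.incl
  haveI : IrreducibleSpace Y.left := GeometricallyIrreducible.irreducibleSpace_of_subsingleton Y.hom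
  haveI : IrreducibleSpace ↥(Y ⊗ Y).left := by
    change IrreducibleSpace ↥(pullback Y.hom Y.hom)
    infer_instance
  have hpre : _root_.IsPreconnected
      (Set.range ⇑((inj ⊗ₘ inj) ≫ Functor.LaxMonoidal.μ (bcFunctor k ℂ) X X).left) :=
    isPreconnected_range (Scheme.Hom.continuous _)
  have hT : IsClopen (Set.range ⇑((bcFunctor k ℂ).map a.nabla.incl).left) :=
    ⟨((bcFunctor k ℂ).map a.nabla.incl).left.isClosedEmbedding.isClosed_range,
      IsOpenImmersion.isOpen_range _⟩
  obtain ⟨y⟩ := (inferInstance : Nonempty Y.left)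
  refine hpre.subset_isClopen hT
    ⟨((inj ⊗ₘ inj) ≫ Functor.LaxMonoidal.μ (bcFunctor k ℂ) X X).left ((lift (𝟙 Y) (𝟙 Y)).left y), ⟨_, rfl⟩, ?_⟩
  refine ⟨((bcFunctor k ℂ).map a.nabla.diag).left (inj.left y), ?_⟩
  have key : inj ≫ (bcFunctor k ℂ).map a.nabla.diag ≫ (bcFunctor k ℂ).map a.nabla.incl =
      lift (𝟙 Y) (𝟙 Y) ≫ (inj ⊗ₘ inj) ≫ Functor.LaxMonoidal.μ (bcFunctor k ℂ) X X := by
    rw [← Functor.map_comp, a.nabla.diag_incl, diag_tensorHom_μ]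
  have h := congrArg (fun φ => φ.left y) key
  simpa only [Over.comp_left, Scheme.Hom.comp_apply] using h

/-- **`Y × Y ⟶ (∇X)_ℂ`**: the lift of `inj × inj` through the open immersion `(∇X)_ℂ ↪ (X × X)_ℂ` (Mathlib
`IsOpenImmersion.lift` on `range_tensorHom_μ_subset_range`), as a morphism over `Spec ℂ`. [cite: Liu2021, §2.1 Def. 2.1 (1) (l. 1171–1174)] -/
def nablaLiftPiece [GeometricallyIrreducible Y.hom] : Y ⊗ Y ⟶ (bcFunctor k ℂ).obj a.nabla.N :=
  haveI := a.nabla.isOpenImmersion_incl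
  haveI := GaloisDescent.isOpenImmersion_bcFunctor_map_left ℂ a.nabla.incl
  Over.homMk
    (IsOpenImmersion.lift ((bcFunctor k ℂ).map a.nabla.incl).left
      ((inj ⊗ₘ inj) ≫ Functor.LaxMonoidal.μ (bcFunctor k ℂ) X X).left (range_tensorHom_μ_subset_range a inj))
    (by
      rw [← Over.w ((bcFunctor k ℂ).map a.nabla.incl), ← Category.assoc, IsOpenImmersion.lift_fac]
      exact Over.w _)

/-- The lift IS a lift: `nablaLiftPiece ≫ (∇X ↪ X × X)_ℂ = (inj × inj) ≫ μ`. [cite: Liu2021, §2.1 Def. 2.1 (1) (l. 1171–1174)] -/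
theorem nablaLiftPiece_incl [GeometricallyIrreducible Y.hom] :
    nablaLiftPiece a inj ≫ (bcFunctor k ℂ).map a.nabla.incl =
      (inj ⊗ₘ inj) ≫ Functor.LaxMonoidal.μ (bcFunctor k ℂ) X X := by
  haveI := a.nabla.isOpenImmersion_incl
  haveI := GaloisDescent.isOpenImmersion_bcFunctor_map_left ℂ a.nabla.incl
  exact Over.OverMorphism.ext (IsOpenImmersion.lift_fac _ _ _)

/-- On the diagonal the lift is the base-changed diagonal of `∇X`: `ΔY ≫ nablaLiftPiece = inj ≫ (X → ∇X)_ℂ` (the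
closed immersion `(∇X)_ℂ ↪ (X × X)_ℂ` is a monomorphism). [cite: Liu2021, §2.1 Def. 2.1 (1) (l. 1171–1174)] -/
theorem diag_nablaLiftPiece [GeometricallyIrreducible Y.hom] :
    lift (𝟙 Y) (𝟙 Y) ≫ nablaLiftPiece a inj = inj ≫ (bcFunctor k ℂ).map a.nabla.diag := by
  haveI := a.nabla.isClosedImmersion_incl
  haveI := GaloisDescent.isClosedImmersion_bcFunctor_map_left ℂ a.nabla.incl
  haveI : Mono ((bcFunctor k ℂ).map a.nabla.incl) := Over.mono_of_mono_left _
  rw [← cancel_mono ((bcFunctor k ℂ).map a.nabla.incl), Category.assoc, nablaLiftPiece_incl, diag_tensorHom_μ,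
    Category.assoc, ← Functor.map_comp, a.nabla.diag_incl]

/-! ## §2 `α` on the piece: `albPair` on `Y × Y` and Liu's `(α_X)_x|_{X_c}` -/

/-- `(α_X)_ℂ : (∇X)_ℂ ⟶ Alb_X ⊗_k ℂ`, the base change of the Albanese morphism, typed into the underlying scheme of the
base-changed abelian variety `a.Alb.baseChange ℂ` (whose underlying `ℂ`-scheme IS `(Alb_X)_ℂ`, `AbelianVariety.baseChange_X`).
[cite: Liu2021, §2.1 Def. 2.3 (l. 1205) and proof of Lemma 2.4 (1) (l. 1220–1222)] -/
def alphaBC : (bcFunctor k ℂ).obj a.nabla.N ⟶ (a.Alb.baseChange ℂ).X :=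
  (bcFunctor k ℂ).map a.α

/-- `(ΔX)_ℂ ≫ (α_X)_ℂ = 0` («`ΔX ⊆ α_X^{-1} 0_A`», `Albanese.diag_α`, base-changed; Mathlib `Functor.map_one` for the monoidal
`Over.pullback`, whose transported group structure IS that of `a.Alb.baseChange ℂ`). [cite: Liu2021, §2.1 Def. 2.3 with the Proposition (l. 1190–1206)] -/
theorem diag_alphaBC : (bcFunctor k ℂ).map a.nabla.diag ≫ alphaBC a = 1 := by
  rw [alphaBC]
  refine ((bcFunctor k ℂ).map_comp a.nabla.diag a.α).symm.trans ?_
  rw [a.diag_α]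
  exact Functor.map_one _

/-- **`α_X` restricted to `Y × Y ⊆ (∇X)_ℂ`**: `Y × Y ⟶ (∇X)_ℂ ⟶ Alb_X ⊗_k ℂ`, `(y, x) ↦ α_X(y, x)` — the two-variable form
of the map `(α_X)_x` of the proof of Lemma 2.4 (1). [cite: Liu2021, §2.1 Def. 2.3 (l. 1202–1208) and proof of Lemma 2.4 (1) (l. 1220–1222)] -/
def albPair [GeometricallyIrreducible Y.hom] : Y ⊗ Y ⟶ (a.Alb.baseChange ℂ).X :=
  nablaLiftPiece a inj ≫ alphaBC a

/-- `albPair` unfolded. [cite: Liu2021, §2.1 Def. 2.3 (l. 1202–1208)] -/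
theorem albPair_def [GeometricallyIrreducible Y.hom] :
    albPair a inj = nablaLiftPiece a inj ≫ alphaBC a := rfl

/-- **`α_X(y, y) = 0` on the piece**: `ΔY ≫ albPair = 1` (from «`ΔX ⊆ α_X^{-1} 0`», `Albanese.diag_α`, base-changed;
Mathlib `Functor.map_one` for the monoidal `Over.pullback`). [cite: Liu2021, §2.1 Def. 2.3 with the Proposition (l. 1190–1206)] -/
theorem diag_albPair [GeometricallyIrreducible Y.hom] : lift (𝟙 Y) (𝟙 Y) ≫ albPair a inj = 1 := by
  rw [albPair_def, ← Category.assoc, diag_nablaLiftPiece, Category.assoc, diag_alphaBC, MonObj.comp_one]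

/-- **Liu's `(α_X)_x` on the piece**: for a point `y₀ ∈ Y(ℂ)`, `albOnPiece a inj y₀ : Y ⟶ Alb_X ⊗_k ℂ`, `y ↦ α_X(y, y₀)` —
`albPair` restricted to `Y × {y₀}` (proof of Lemma 2.4 (1), l. 1220–1222: «we pick an element `x` […] which induces a morphism
`(α_X)_x : X ⊗_{k,τ} ℂ → Alb_X ⊗_{k,τ} ℂ`», on the component of `x`). [cite: Liu2021, proof of Lemma 2.4 (1) (l. 1220–1222); §4.2 (4.1)] -/
def albOnPiece [GeometricallyIrreducible Y.hom] (y₀ : AlgPoints Y ℂ) : Y ⟶ (a.Alb.baseChange ℂ).X :=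
  lift (𝟙 Y) (toSpecOver Y ≫ y₀) ≫ albPair a inj

/-- `albOnPiece` unfolded. [cite: Liu2021, proof of Lemma 2.4 (1) (l. 1220–1222)] -/
theorem albOnPiece_def [GeometricallyIrreducible Y.hom] (y₀ : AlgPoints Y ℂ) :
    albOnPiece a inj y₀ = lift (𝟙 Y) (toSpecOver Y ≫ y₀) ≫ albPair a inj := rfl

/-- **`(α_X)_{y₀}(y₀) = 0`**: the base point goes to the origin. [cite: Liu2021, proof of Lemma 2.4 (1) (l. 1220–1222)] -/
theorem point_albOnPiece [GeometricallyIrreducible Y.hom] (y₀ : AlgPoints Y ℂ) : y₀ ≫ albOnPiece a inj y₀ = 1 := by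
  rw [albOnPiece_def, comp_lift_assoc, Category.comp_id, ← Category.assoc y₀ (toSpecOver Y),
    AlgPoints.self_comp_toSpecOver, Category.id_comp,
    show lift y₀ y₀ = y₀ ≫ lift (𝟙 Y) (𝟙 Y) by simp, Category.assoc, diag_albPair, MonObj.comp_one]

/-! ## §3 ONE Jacobian factorisation for all base points (Milne, Jacobian Varieties, Prop. 6.1 ∕ 6.4) -/

/-- **The homomorphism `ψ : J(Y) → Alb_X ⊗_k ℂ` through which `α_X|_{Y × Y}` factors**: `albPair` is trivial on the diagonal, so
it factors through the difference map of ANY Albanese ∕ Jacobian datum `𝒥` of the piece (`Jacobian.desc`, Milne Prop. 6.4).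
[cite: Milne1986JacobianVarieties, §6 Prop. 6.4] [cite: Liu2021, proof of Lemma 2.4 (1) (l. 1220–1226)] -/
def albDesc [GeometricallyIrreducible Y.hom] (𝒥 : Jacobian Y) : 𝒥.J ⟶ a.Alb.baseChange ℂ :=
  𝒥.desc (albPair a inj) (diag_albPair a inj)

/-- `diff ≫ ψ = albPair` (`Jacobian.fac`). [cite: Milne1986JacobianVarieties, §6 Prop. 6.4] -/
theorem diff_albDesc [GeometricallyIrreducible Y.hom] (𝒥 : Jacobian Y) :
    𝒥.diff ≫ (albDesc a inj 𝒥).hom.hom.hom = albPair a inj :=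
  𝒥.fac _ _

/-- **`(α_X)_{y₀}|_Y = f^{y₀} ≫ ψ` with ONE `ψ` for EVERY base point `y₀`** (restrict `diff ≫ ψ = albPair` to `Y × {y₀}`;
`𝒥.abelJacobi y₀ = (𝟙, y₀) ≫ diff`).  The formula (J3) needs. [cite: Milne1986JacobianVarieties, §6 Prop. 6.1] [cite: Liu2021, proof of Lemma 2.4 (1) (l. 1220–1226)] -/
theorem albOnPiece_eq_abelJacobi_comp [GeometricallyIrreducible Y.hom] (𝒥 : Jacobian Y) (y₀ : AlgPoints Y ℂ) :
    albOnPiece a inj y₀ = 𝒥.abelJacobi y₀ ≫ (albDesc a inj 𝒥).hom.hom.hom := by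
  rw [albOnPiece_def, Jacobian.abelJacobi, Category.assoc, diff_albDesc]

/-- `ψ` is the pointed descent of `(α_X)_{y₀}|_Y` for every `y₀` (`Jacobian.descPointed_unique`). [cite: Milne1986JacobianVarieties, §6 Prop. 6.1] -/
theorem albDesc_eq_descPointed [GeometricallyIrreducible Y.hom] (𝒥 : Jacobian Y) (y₀ : AlgPoints Y ℂ) :
    albDesc a inj 𝒥 = 𝒥.descPointed y₀ (albOnPiece a inj y₀) (point_albOnPiece a inj y₀) :=
  𝒥.descPointed_unique y₀ _ _ _ (albOnPiece_eq_abelJacobi_comp a inj 𝒥 y₀).symm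

/-! ## §4 Change of base point is a translation; `Hⁱ` does not see it -/

/-- **Change of base point is a translation** (given a Jacobian datum of the piece): `(α_X)_{y₁}|_Y = (α_X)_{y₀}|_Y · c` with
`c` the constant map at `ψ(f^{y₀}(y₁))⁻¹` — from `f^{y₁} = f^{y₀} · [y₀ − y₁]` (Milne §2, tree `Jacobian.abelJacobi_eq_mul_const`)
and §3. [cite: Milne1986JacobianVarieties, §2 (after the definition of f^P)] [cite: Liu2021, proof of Lemma 2.4 (1) (l. 1226–1228)] -/
theorem albOnPiece_eq_mul_const_of_jacobian [GeometricallyIrreducible Y.hom] (𝒥 : Jacobian Y) (y₀ y₁ : AlgPoints Y ℂ) :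
    albOnPiece a inj y₁ = albOnPiece a inj y₀ *
      (toSpecOver Y ≫ (y₁ ≫ 𝒥.abelJacobi y₀ ≫ (albDesc a inj 𝒥).hom.hom.hom)⁻¹) := by
  rw [albOnPiece_eq_abelJacobi_comp a inj 𝒥 y₁, albOnPiece_eq_abelJacobi_comp a inj 𝒥 y₀, 𝒥.abelJacobi_eq_mul_const y₀ y₁,
    MonObj.mul_comp, Category.assoc, GrpObj.inv_comp]
  simp only [Category.assoc]

/-- **Change of base point is a translation**: for a smooth projective (geometrically irreducible) piece `Y` there is a point
`c ∈ (Alb_X ⊗ ℂ)(ℂ)` with `(α_X)_{y₁}|_Y = (α_X)_{y₀}|_Y · c` (a Jacobian datum of `Y` exists: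
`Motives.nonempty_jacobian_of_isSmoothProjective_complex_of_dim`). «it is independent of the choice of `x` since translation acts
trivially», l. 1226–1228. [cite: Liu2021, proof of Lemma 2.4 (1) (l. 1226–1228)] [cite: Milne1986JacobianVarieties, §2] -/
theorem albOnPiece_eq_mul_const {n : ℕ} (hY : IsSmoothProjective n Y) (y₀ y₁ : AlgPoints Y ℂ) :
    haveI := hY.geometricallyIrreducible
    ∃ c : (a.Alb.baseChange ℂ).Points ℂ, albOnPiece a inj y₁ = albOnPiece a inj y₀ * (toSpecOver Y ≫ c) := by
  haveI := hY.geometricallyIrreducible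
  obtain ⟨𝒥⟩ := nonempty_jacobian_of_isSmoothProjective_complex_of_dim Y hY
  exact ⟨_, albOnPiece_eq_mul_const_of_jacobian a inj 𝒥 y₀ y₁⟩

/-- **`(α_X)_x^*` on `Hⁱ` does not depend on `x`** (given a Jacobian datum): `((α_X)_{y₁}|_Y)^* = ((α_X)_{y₀}|_Y)^*` on
`Hⁱ((Alb_X ⊗ ℂ)(ℂ); ℚ)` — translations of the path-connected group act trivially (tree
`AbelianVariety.bettiCohomology_map_mul_const`). [cite: Liu2021, proof of Lemma 2.4 (1) (l. 1226–1228)] [cite: HatcherAT2002, §3.1 p. 201] -/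
theorem pull_albOnPiece_eq_of_point_of_jacobian [GeometricallyIrreducible Y.hom] (𝒥 : Jacobian Y)
    (y₀ y₁ : AlgPoints Y ℂ) (i : ℕ) :
    BettiUniverse.pull (albOnPiece a inj y₁) i = BettiUniverse.pull (albOnPiece a inj y₀) i := by
  rw [albOnPiece_eq_mul_const_of_jacobian a inj 𝒥 y₀ y₁]
  change (bettiCohomology.map _ i).hom = (bettiCohomology.map _ i).hom
  rw [AbelianVariety.bettiCohomology_map_mul_const (A := a.Alb.baseChange ℂ)]

/-- **`(α_X)_x^*` on `Hⁱ` does not depend on `x`**, for a smooth projective piece. [cite: Liu2021, proof of Lemma 2.4 (1) (l. 1226–1228)] [cite: HatcherAT2002, §3.1 p. 201] -/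
theorem pull_albOnPiece_eq_of_point {n : ℕ} (hY : IsSmoothProjective n Y) (y₀ y₁ : AlgPoints Y ℂ) (i : ℕ) :
    haveI := hY.geometricallyIrreducible
    BettiUniverse.pull (albOnPiece a inj y₁) i = BettiUniverse.pull (albOnPiece a inj y₀) i := by
  haveI := hY.geometricallyIrreducible
  obtain ⟨𝒥⟩ := nonempty_jacobian_of_isSmoothProjective_complex_of_dim Y hY
  exact pull_albOnPiece_eq_of_point_of_jacobian a inj 𝒥 y₀ y₁ i

/-! ## §5 The transition ∕ Hecke square along `u : X' ⟶ X` -/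

section Transition

variable {X' : SchemeOver k} (a' : Albanese X') (u : X' ⟶ X)
  (nT : a'.nabla.N ⟶ a.nabla.N) (At : a'.Alb ⟶ a.Alb)
  {Y' : SchemeOver ℂ} (inj' : Y' ⟶ (bcFunctor k ℂ).obj X') (v : Y' ⟶ Y)

/-- **The lifts commute with `∇u`**: if `nT : ∇X' → ∇X` covers `u × u` (the field `Sec42Data.nablaTr_incl`) and the pieces
correspond under `u_ℂ` (`v ≫ inj = inj' ≫ u_ℂ`), then `nablaLiftPiece' ≫ (∇u)_ℂ = (v × v) ≫ nablaLiftPiece` (both followed by the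
monomorphism `(∇X ↪ X × X)_ℂ` give `(inj' × inj') ≫ μ ≫ (u × u)_ℂ`, naturality of `μ`). [cite: Liu2021, §2.1 Def. 2.1 (1) (l. 1174: «`u × u` restricts to a morphism `∇u : ∇Y → ∇X`»)] -/
theorem nablaLiftPiece_comp_map [GeometricallyIrreducible Y.hom] [GeometricallyIrreducible Y'.hom]
    (hnT : nT ≫ a.nabla.incl = a'.nabla.incl ≫ (u ⊗ₘ u)) (hv : v ≫ inj = inj' ≫ (bcFunctor k ℂ).map u) :
    nablaLiftPiece a' inj' ≫ (bcFunctor k ℂ).map nT = (v ⊗ₘ v) ≫ nablaLiftPiece a inj := by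
  haveI := a.nabla.isClosedImmersion_incl
  haveI := GaloisDescent.isClosedImmersion_bcFunctor_map_left ℂ a.nabla.incl
  haveI : Mono ((bcFunctor k ℂ).map a.nabla.incl) := Over.mono_of_mono_left _
  rw [← cancel_mono ((bcFunctor k ℂ).map a.nabla.incl), Category.assoc, Category.assoc, ← Functor.map_comp, hnT,
    Functor.map_comp, ← Category.assoc, nablaLiftPiece_incl, nablaLiftPiece_incl, Category.assoc,
    ← Functor.LaxMonoidal.μ_natural, ← Category.assoc, ← Category.assoc, tensorHom_comp_tensorHom,
    tensorHom_comp_tensorHom, hv]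

/-- **THE TRANSITION SQUARE for `α` on pieces**: with `At : Alb_{X'} → Alb_X` satisfying `α' ≫ At = ∇u ≫ α` (VERBATIM the
field `Sec42Data.α_Atr`, READING G3 of Def. 2.3 «`Alb_u ∘ α_Y = α_X ∘ ∇u`»; the same shape for the Hecke translates
`HeckeTranslates.albTr`), `albPair a' inj' ≫ (At)_ℂ = (v × v) ≫ albPair a inj`. [cite: Liu2021, §2.1 Def. 2.3 (l. 1207) and §4.2 l. 2070–2074] -/
theorem albPair_comp_baseChange [GeometricallyIrreducible Y.hom] [GeometricallyIrreducible Y'.hom]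
    (hnT : nT ≫ a.nabla.incl = a'.nabla.incl ≫ (u ⊗ₘ u)) (hAt : a'.α ≫ At.hom.hom.hom = nT ≫ a.α)
    (hv : v ≫ inj = inj' ≫ (bcFunctor k ℂ).map u) :
    albPair a' inj' ≫ (AbelianVariety.Hom.baseChange ℂ At).hom.hom.hom = (v ⊗ₘ v) ≫ albPair a inj := by
  have hα : alphaBC a' ≫ (AbelianVariety.Hom.baseChange ℂ At).hom.hom.hom = (bcFunctor k ℂ).map nT ≫ alphaBC a := by
    show (bcFunctor k ℂ).map a'.α ≫ (bcFunctor k ℂ).map At.hom.hom.hom = (bcFunctor k ℂ).map nT ≫ (bcFunctor k ℂ).map a.α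
    rw [← Functor.map_comp, hAt, Functor.map_comp]
  rw [albPair_def, albPair_def, Category.assoc, hα, ← Category.assoc,
    nablaLiftPiece_comp_map a inj a' u nT inj' v hnT hv, Category.assoc]

/-- **The transition square, pointed form**: `(α_{X'})_{y'}|_{Y'} ≫ (At)_ℂ = v ≫ (α_X)_{v(y')}|_Y` — EXACT (no translation)
when the base point of `Y` is the image of that of `Y'`. [cite: Liu2021, §2.1 Def. 2.3 (l. 1207) and §4.2 l. 2070–2074] -/
theorem albOnPiece_comp_baseChange [GeometricallyIrreducible Y.hom] [GeometricallyIrreducible Y'.hom]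
    (hnT : nT ≫ a.nabla.incl = a'.nabla.incl ≫ (u ⊗ₘ u)) (hAt : a'.α ≫ At.hom.hom.hom = nT ≫ a.α)
    (hv : v ≫ inj = inj' ≫ (bcFunctor k ℂ).map u) (y' : AlgPoints Y' ℂ) :
    albOnPiece a' inj' y' ≫ (AbelianVariety.Hom.baseChange ℂ At).hom.hom.hom = v ≫ albOnPiece a inj (y' ≫ v) := by
  rw [albOnPiece_def, albOnPiece_def, Category.assoc, albPair_comp_baseChange a inj a' u nT At inj' v hnT hAt hv,
    ← Category.assoc, ← Category.assoc, lift_map, comp_lift, Category.id_comp, Category.comp_id, Category.assoc,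
    ← Category.assoc v (toSpecOver Y), Jacobian.comp_toSpecOver]

/-- **The transition square on `Hⁱ`, ANY base points** (for smooth projective pieces): `((α')_{y'}|_{Y'})^* ∘ (At)_ℂ^* =
v^* ∘ ((α)_{y}|_Y)^*` on `Hⁱ((Alb_X ⊗ ℂ)(ℂ); ℚ)` — the pointed square and base-point independence on `Hⁱ` (§4).  The shape of the
level-transition law `phiStar_comp` ∕ the Hecke law of the Δ2 bridge's S2. [cite: Liu2021, §4.2 l. 2070–2074 and proof of Lemma 2.4 (1) (l. 1226–1228)] -/
theorem pull_albOnPiece_comp_baseChange {n n' : ℕ} (hY : IsSmoothProjective n Y) (hY' : IsSmoothProjective n' Y')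
    (hnT : nT ≫ a.nabla.incl = a'.nabla.incl ≫ (u ⊗ₘ u)) (hAt : a'.α ≫ At.hom.hom.hom = nT ≫ a.α)
    (hv : v ≫ inj = inj' ≫ (bcFunctor k ℂ).map u) (y' : AlgPoints Y' ℂ) (y : AlgPoints Y ℂ) (i : ℕ) :
    haveI := hY.geometricallyIrreducible
    haveI := hY'.geometricallyIrreducible
    BettiUniverse.pull (albOnPiece a' inj' y') i ∘ₗ
        BettiUniverse.pull (AbelianVariety.Hom.baseChange ℂ At).hom.hom.hom i =
      BettiUniverse.pull v i ∘ₗ BettiUniverse.pull (albOnPiece a inj y) i := by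
  haveI := hY.geometricallyIrreducible
  haveI := hY'.geometricallyIrreducible
  rw [← BettiUniverse.pull_comp, ← BettiUniverse.pull_comp, albOnPiece_comp_baseChange a inj a' u nT At inj' v hnT hAt hv,
    BettiUniverse.pull_comp, BettiUniverse.pull_comp, pull_albOnPiece_eq_of_point a inj hY y (y' ≫ v)]

end Transition

end Summit.HodgeConjecture.CorCM.D2Bridge

end
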